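import Mathlib
import HarnessLib
import Summits.HubbardSuperconductivity.HubbardSuperconductivity.Theorems.WeakCouplingBCSDefs

/-!
# Route `WeakCouplingBCS` — certificate vocabulary for `WcbcsKohnLuttingerB1g` (stmt-HubbardSuperconductivity-0158):
# the named numerical hypothesis of the TWO-SIDED window records

`KLCert.EnclosuresB1g` (`Theorems/WeakCouplingBCSDefs.lean`) names, per box and uniformly in `μ`, the Ritz rows E1–E2 of the `B1g` block
and the block enclosures E1–E4 of the four other channels — enough for SELECTION and for an UPPER bound on the `B1g` bottom (hence a
LOWER bound on the Kohn–Luttinger coupling `-channelInf ε₀ μ 1 B1g`).  A certified LOWER bound on the `B1g` bottom — i.e. an UPPER bound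
on the coupling, which makes the onset constant of the leaf `H1TwoPointLimitKLOnsetD` explicit — needs the `B1g` block's own rows E3
(`∫ (κΦ_B)² dσ ≤ Thi`) and E4 (`∫∫ (K_B1g - Σ c u⊗u)² ≤ Hhi`, a deflation of the positive `B1g` modes), read by the SAME block-level
soundness theorem of the tree (`stub_klBlockBounds`, any channel: `lowerOK → lower ≤ channelInf ε₀ μ 1 χ`, Temple or far-channel bound).
This file only NAMES that hypothesis on the unchanged record type `KLCert`:

* `KLCert.EnclosuresB1gT` — on every box, uniformly in `μ`, the block enclosures E1–E4 (`KLBlock.Enclosure`) of ALL FIVE channel blocks.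

It implies `KLCert.EnclosuresB1g` for records accepted by `checkB1gD` (proved in the companion proof file, not here); the checker of the
two-sided records is `checkB1gD` together with the kernel-decidable per-box test `bB1g.lowerOK trials B1g` (no new checker is defined).
References: M. Reed, B. Simon, *Methods of Modern Mathematical Physics IV*, Thm. XIII.5 (Temple); S. Raghu, S. A. Kivelson,
D. J. Scalapino, Phys. Rev. B 81 (2010) 224505, §II (7), (13).
-/

noncomputable section

namespace Summit.HubbardSuperconductivity.HubbardSuperconductivity.Theorems.CwKLChiralWindow

set_option linter.dupNamespace false -- summit = problem name (single-conjunct summit), D-0017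

open MeasureTheory Literature.MathematicalPhysics.QuantumLattice

/-- **The named numerical hypothesis of the two-sided window records** (certified interval arithmetic): on every box of the record and
for every `μ` in the box, the block enclosures E1–E4 (`KLBlock.Enclosure`: trial norm, Rayleigh numerator and image norm of the block's
trial if it is used, and the deflated sector square mass) of the blocks of all five channels `A1g, A2g, B1g, B2g, E`.  Every conjunct is
an inequality between an explicit integral against the tree's Fermi-curve measure and a rational of the record. [folklore] -/
def KLCert.EnclosuresB1gT (c : KLCert) : Prop :=
  ∀ bx ∈ c.boxes, ∀ μ ∈ Set.Icc (bx.mulo : ℝ) (bx.muhi : ℝ), ∀ χ : D4Irrep, (bx.blk χ).Enclosure c.trials μ χ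

end Summit.HubbardSuperconductivity.HubbardSuperconductivity.Theorems.CwKLChiralWindow

end
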